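import Summits.HodgeConjecture.HodgeConjecture.Theorems.Q8SymplecticPowersQuaternionicTensorFFT
import Summits.HodgeConjecture.HodgeConjecture.Theorems.Q8SymplecticPowersEndomorphismMatrix
import HarnessLib

/-!
# Route `Q8SymplecticPowers`, programme K2Q ∕ F-Q — brick F1D: **the quaternionic tensor FFT in matrix form**
# (the currency of the Cayley ascent ASC-Q)

Support file for crux K2Q `PowersHodgeOfQuaternionCommutators` (stmt-HodgeConjecture-24191; `--supports … --as helper`;
nothing here closes an item). Prover seat `hodge-nonav-20241-p1` (g21). Pure linear algebra.

`mem_span_taggedContraction_of_cayley_commutator_matrices` — for matrices `A, B, G ∈ M_n(K)` over a field `K` of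
characteristic `0` with `i² = −1`, `A² = B² = −1`, `AB = −BA`, both `G`-orthogonal for a symmetric invertible `G`, and a
coefficient tensor `c : (Fin m → Fin n) → K` fixed by the Kronecker power of `g h g⁻¹ h⁻¹` for all `g, h` commuting with
`A, B`, preserving `G` and with `det(1 + g)`, `det(1 + h)` units (exactly the conclusion of ASC-Q
`commutator_invariance_ascends₂`, p709049, for `K = ℂ`): `c` is a `K`-combination of the tagged contractions
`taggedContraction (d ↦ D_d G⁻¹) e δ`, `D = (1, A, B, AB)` — the twin, in all degrees, of E-Q2a
`exists_eq_quaternion_of_commute_cayley_commutators` (degree 2). It is brick F1C-c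
`mem_span_taggedContraction_of_cayley_commutators` on `V = K^n` with the standard basis, `Q = toBilin' G`,
`a = toLin' A`, `b = toLin' B`.

HONEST FRAMING: linear algebra only (axioms standard); item 24191 OPEN; nothing here says HC ∕ HC_CM ∕ HC_AV is proved.

## References

* R. Goodman, N. Wallach, *Symmetry, Representations, and Invariants*, GTM 255, §5.3.2 Thm. 5.3.3 (2), §2.2.3 Exercise 1,
  §1.4.5 Exercise 5. [cite: GoodmanWallachGTM255]
-/

set_option linter.dupNamespace false

noncomputable section

open Module Matrix
open scoped BigOperators Matrix

namespace Summit.HodgeConjecture.HodgeConjecture.Theorems.Q8SymplecticPowersQuaternionicTensorFFTMatrix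

open Literature.RepresentationTheory.ClassicalInvariants (taggedContraction)
open Literature.NumberTheory.DiophantineGeometry (tensorPowerMatrix tensorPowerMatrix_apply)
open Summit.HodgeConjecture.HodgeConjecture.Theorems.Q8SymplecticPowersQuaternionicTensorFFT
open Summit.HodgeConjecture.HodgeConjecture.Theorems.Q8SymplecticPowersEndomorphismMatrix (toMatrix'_commutator)

universe u

variable {K : Type u} [Field K] {n : ℕ}

/-- **The quaternionic tensor FFT in matrix form.** For `A, B, G ∈ M_n(K)` (`char K = 0`, `i² = −1`) with
`A² = B² = −1`, `AB = −BA`, `AᵀGA = G = BᵀGB`, `Gᵀ = G`, `det G ≠ 0`: a coefficient tensor `c : (Fin m → Fin n) → K` fixed by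
the Kronecker power of every commutator `g h g⁻¹ h⁻¹` of matrices `g, h` commuting with `A, B`, preserving `G`, with
`det(1 + g)`, `det(1 + h)` units, is a `K`-combination of the tagged contractions with pair matrices `D_d G⁻¹`,
`D = (1, A, B, AB)`. [cite: GoodmanWallachGTM255, §5.3.2 Thm. 5.3.3 (2), §2.2.3 Exercise 1 and §1.4.5 Exercise 5] -/
theorem mem_span_taggedContraction_of_cayley_commutator_matrices [CharZero K] {m : ℕ} (A B G : Matrix (Fin n) (Fin n) K)
    {i : K} (hA : A * A = -1) (hB : B * B = -1) (hAB : A * B = -(B * A)) (hAG : Aᵀ * G * A = G) (hBG : Bᵀ * G * B = G)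
    (hGt : Gᵀ = G) (hG : IsUnit G.det) (hi : i * i = -1) (c : (Fin m → Fin n) → K)
    (hc : ∀ g h : Matrix (Fin n) (Fin n) K, IsUnit (1 + g).det → IsUnit (1 + h).det →
      g * A = A * g → h * A = A * h → g * B = B * g → h * B = B * h → gᵀ * G * g = G → hᵀ * G * h = G →
      tensorPowerMatrix K n m (g * h * g⁻¹ * h⁻¹) *ᵥ c = c) :
    c ∈ Submodule.span K {f : (Fin m → Fin n) → K | ∃ (j : ℕ) (e : Fin m ≃ Fin 2 × Fin j) (δ : Fin j → Fin 4),
      f = taggedContraction (fun d : Fin 4 => (![(1 : Matrix (Fin n) (Fin n) K), A, B, A * B] : Fin 4 → _) d * G⁻¹) e δ} := by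
  classical
  -- the data of brick F1C-c on `V = K^n`
  let bV : Basis (Fin n) K (Fin n → K) := Pi.basisFun K (Fin n)
  let Q : LinearMap.BilinForm K (Fin n → K) := Matrix.toBilin' G
  let a : (Fin n → K) →ₗ[K] (Fin n → K) := Matrix.toLin' A
  let b : (Fin n → K) →ₗ[K] (Fin n → K) := Matrix.toLin' B
  have hQ : ∀ x y, Q x y = x ⬝ᵥ (G *ᵥ y) := fun x y => Matrix.toBilin'_apply' G x y
  have hQs : ∀ x y, Q x y = Q y x := fun x y => by
    rw [hQ, hQ, Matrix.dotProduct_mulVec, dotProduct_comm, ← Matrix.mulVec_transpose, hGt]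
  have hQn : Q.Nondegenerate :=
    (Matrix.nondegenerate_toBilin'_iff (M := G)).2 (Matrix.nondegenerate_of_det_ne_zero (isUnit_iff_ne_zero.1 hG))
  have ha : ∀ x, a x = A *ᵥ x := fun x => Matrix.toLin'_apply A x
  have hb : ∀ x, b x = B *ᵥ x := fun x => Matrix.toLin'_apply B x
  have haa : ∀ x, a (a x) = -x := fun x => by rw [ha, ha, Matrix.mulVec_mulVec, hA, Matrix.neg_mulVec, Matrix.one_mulVec]
  have hbb : ∀ x, b (b x) = -x := fun x => by rw [hb, hb, Matrix.mulVec_mulVec, hB, Matrix.neg_mulVec, Matrix.one_mulVec]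
  have hab : ∀ x, a (b x) = -b (a x) := fun x => by
    rw [ha, hb, ha, hb, Matrix.mulVec_mulVec, Matrix.mulVec_mulVec, hAB, Matrix.neg_mulVec]
  have hcompQ : ∀ (S : Matrix (Fin n) (Fin n) K), Sᵀ * G * S = G →
      ∀ x y, Q (Matrix.toLin' S x) (Matrix.toLin' S y) = Q x y := by
    intro S hS x y
    have h := Matrix.toBilin'_comp G S S
    rw [hS] at h
    have h' := congr_arg (fun D : LinearMap.BilinForm K (Fin n → K) => D x y) h
    simpa only [LinearMap.BilinForm.comp_apply] using h'
  have haQ : ∀ x y, Q (a x) (a y) = Q x y := hcompQ A hAG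
  have hbQ : ∀ x y, Q (b x) (b y) = Q x y := hcompQ B hBG
  -- matrices in the standard basis
  have htoM : ∀ f : (Fin n → K) →ₗ[K] (Fin n → K), LinearMap.toMatrix bV bV f = LinearMap.toMatrix' f := fun f => by
    rw [LinearMap.toMatrix_eq_toMatrix']
  have hGm : LinearMap.BilinForm.toMatrix bV Q = G := by
    rw [LinearMap.BilinForm.toMatrix_basisFun, LinearMap.BilinForm.toMatrix'_toBilin']
  have hfam : (fun d : Fin 4 => LinearMap.toMatrix bV bV ((![(1 : (Fin n → K) →ₗ[K] (Fin n → K)), a, b, a * b] :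
      Fin 4 → _) d) * (LinearMap.BilinForm.toMatrix bV Q)⁻¹) =
      fun d : Fin 4 => (![(1 : Matrix (Fin n) (Fin n) K), A, B, A * B] : Fin 4 → _) d * G⁻¹ := by
    funext d
    rw [hGm, htoM]
    fin_cases d
    · simp [show (1 : (Fin n → K) →ₗ[K] (Fin n → K)) = LinearMap.id from rfl, LinearMap.toMatrix'_id]
    · simp [a, LinearMap.toMatrix'_toLin']
    · simp [b, LinearMap.toMatrix'_toLin']
    · simp [a, b, LinearMap.toMatrix'_mul, LinearMap.toMatrix'_toLin']
  -- invariance under the Cayley commutators of `GL(V)`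
  have hcV : ∀ g h : (Fin n → K) ≃ₗ[K] (Fin n → K), (∀ x, g (a x) = a (g x)) → (∀ x, g (b x) = b (g x)) →
      (∀ x y, Q (g x) (g y) = Q x y) → (∀ x, h (a x) = a (h x)) → (∀ x, h (b x) = b (h x)) →
      (∀ x y, Q (h x) (h y) = Q x y) →
      IsUnit (LinearMap.det ((g : (Fin n → K) →ₗ[K] (Fin n → K)) + 1)) →
      IsUnit (LinearMap.det ((h : (Fin n → K) →ₗ[K] (Fin n → K)) + 1)) →
      tensorPowerMatrix K n m (LinearMap.toMatrix bV bV ((g * h * g⁻¹ * h⁻¹ : (Fin n → K) ≃ₗ[K] (Fin n → K)) :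
        (Fin n → K) →ₗ[K] (Fin n → K))) *ᵥ c = c := by
    intro g h hga hgb hgQ hha hhb hhQ hg1 hh1
    have comm : ∀ (e : (Fin n → K) ≃ₗ[K] (Fin n → K)) (S : Matrix (Fin n) (Fin n) K),
        (∀ x, e (Matrix.toLin' S x) = Matrix.toLin' S (e x)) →
        LinearMap.toMatrix' (e : (Fin n → K) →ₗ[K] (Fin n → K)) * S = S * LinearMap.toMatrix' (e : _ →ₗ[K] _) := by
      intro e S he
      have hcomp : (e : (Fin n → K) →ₗ[K] (Fin n → K)) ∘ₗ Matrix.toLin' S = Matrix.toLin' S ∘ₗ (e : _ →ₗ[K] _) :=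
        LinearMap.ext he
      have := congr_arg LinearMap.toMatrix' hcomp
      rwa [LinearMap.toMatrix'_comp, LinearMap.toMatrix'_comp, LinearMap.toMatrix'_toLin'] at this
    have isom : ∀ (e : (Fin n → K) ≃ₗ[K] (Fin n → K)), (∀ x y, Q (e x) (e y) = Q x y) →
        (LinearMap.toMatrix' (e : (Fin n → K) →ₗ[K] (Fin n → K)))ᵀ * G * LinearMap.toMatrix' (e : _ →ₗ[K] _) = G := by
      intro e he
      have hcomp : Q.comp (e : (Fin n → K) →ₗ[K] (Fin n → K)) (e : _ →ₗ[K] _) = Q :=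
        LinearMap.ext fun x => LinearMap.ext fun y => he x y
      have := congr_arg LinearMap.BilinForm.toMatrix' hcomp
      rwa [LinearMap.BilinForm.toMatrix'_comp, show LinearMap.BilinForm.toMatrix' Q = G from
        LinearMap.BilinForm.toMatrix'_toBilin' G] at this
    have cayley : ∀ (e : (Fin n → K) ≃ₗ[K] (Fin n → K)),
        IsUnit (LinearMap.det ((e : (Fin n → K) →ₗ[K] (Fin n → K)) + 1)) →
        IsUnit (1 + LinearMap.toMatrix' (e : (Fin n → K) →ₗ[K] (Fin n → K))).det := by
      intro e he
      rwa [← LinearMap.det_toMatrix', map_add, show (1 : (Fin n → K) →ₗ[K] (Fin n → K)) = LinearMap.id from rfl,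
        LinearMap.toMatrix'_id, add_comm] at he
    set γ := LinearMap.toMatrix' (g : (Fin n → K) →ₗ[K] (Fin n → K)) with hγ
    set δ := LinearMap.toMatrix' (h : (Fin n → K) →ₗ[K] (Fin n → K)) with hδ
    have hM := hc γ δ (cayley g hg1) (cayley h hh1) (comm g A hga) (comm h A hha) (comm g B hgb) (comm h B hhb)
      (isom g hgQ) (isom h hhQ)
    rw [htoM, toMatrix'_commutator]
    exact hM
  have hmain := mem_span_taggedContraction_of_cayley_commutators hQs hQn haa hbb hab haQ hbQ hi bV c hcV
  rw [hfam] at hmain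
  exact hmain

end Summit.HodgeConjecture.HodgeConjecture.Theorems.Q8SymplecticPowersQuaternionicTensorFFTMatrix

end
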